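import Literature.Algebra.Lie.LefschetzModuleSL2Representation
import Literature.Algebra.Lie.LefschetzModuleTransport
import Literature.Algebra.Lie.LefschetzModuleWeylOperatorTensor
import Literature.Algebra.Lie.LefschetzModuleInvariantForm
import Literature.Algebra.Lie.LefschetzModuleSelfAdjoint
import HarnessLib

/-!
# Functoriality of the `SL₂(K)`-representation of a Lefschetz module: transport along intertwining maps, tensor products
# (Künneth), direct sums, and invariance of the bilinear forms preserved by `h` and `e`

[topic Algebra/Lie]

Layer `Literature/Algebra/Lie` (namespace `Literature.Algebra.Lie`), lane `lit-hodgefound` (Track 2 foundations library; prover seat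
`lit-hodgefound-p34`, generation 38, row g38-#3), the sequel of `LefschetzModuleSL2Representation.lean` (row g38-#1: a Lefschetz module
`(M, h, e)` over a field `K` of characteristic `0` integrates to `HasLefschetzProperty.sl2Rep : SL(2, K) →* End_K(M)`, `ρ(1 a ; 0 1) = exp(a e)`,
`ρ(1 0 ; a 1) = exp(a f)`, `ρ(0 −1 ; 1 0) = w`, `ρ(diag(t, t⁻¹)) = tʰ` — Beauville 2010, §3).  THEOREMS ONLY (no `def`, no named fact,
no instance, no notation; net debt `0`).

## Sources, VERBATIM

* A. Beauville, *The action of SL₂ on abelian varieties*, J. Ramanujan Math. Soc. 25 (2010), arXiv:0805.1541 [Beauville2010SL2], §3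
  Theorem (held `paper:arxiv-0805.1541` p0004): "there is a (unique) morphism of groups `SL₂ → …` …"; the representation is determined
  by its values on the unipotent one-parameter subgroups, which are the exponentials of the nilpotents `e`, `f` of the `𝔰𝔩₂`-triple.
* Y. André, *Pour une théorie inconditionnelle des motifs*, Publ. Math. IHÉS 83 (1996) [Andre1996Motifs], §1.2 (p. 11: the operators
  attached to the Lefschetz `𝔰𝔩₂` are "compatibles à l'extension des scalaires et aux isomorphismes"), §1.3 (p. 12: "L'isomorphisme
  (d'algèbres graduées) de Künneth : `H*(X × Y) ≅ H*(X) ⊗ H*(Y)` devient un isomorphisme de `𝔰𝔩₂`-modules si l'on munit `X × Y` du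
  faisceau inversible ample `pr_X* 𝓛_X ⊗ pr_Y* 𝓛_Y`"; p. 13: "La formule pour l'involution de Hodge découle de son interprétation en termes
  de l'élément `(0 1 ; −1 0)` de `SL₂`"), §1.1 (p. 11: "`L` […] auto-adjoint", "`ᶜΛ` […] auto-adjoint" for a Poincaré-type pairing).
* E. Looijenga, V. A. Lunts, *A Lie algebra attached to a projective variety*, Invent. Math. 129 (1997) [LooijengaLunts1997], §1 (1.1)
  (p. 4: "there exists a unique `K`-linear transformation `f` in `M` of degree `−2` such that `[e, f] = h`"; "The collection of Lefschetz
  modules is closed under direct sums, tensor products"), (1.3) (p. 5: "Suppose `φ : M × M → K` is a bilinear form such that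
  `φ(e x, y) + φ(x, e y) = 0` for `e ∈ 𝔞` and `φ` is zero on `M_k × M_l` unless `k + l = 0` … So `𝔤(𝔞, M)` is then a subalgebra of
  `aut(M, φ)`").

## What is PROVED (`ρ_M = L.sl2Rep hgr`; `exp` is Mathlib's `IsNilpotent.exp` for the `ℚ`-algebra structure `ℚ → K → End_K(M)`)

* §1 TRANSPORT (André §1.2, Looijenga–Lunts (1.1) uniqueness, at group level). For a `K`-linear `Φ : M → M'` with `Φ h = h' Φ`,
  `Φ e = e' Φ`: `IsZGrading.map_torus_of_semiconj` (`Φ tʰ = tʰ' Φ`), **`HasLefschetzProperty.map_sl2Rep_of_semiconj`**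
  (`Φ ρ_M(γ) = ρ_{M'}(γ) Φ` for every `γ ∈ SL₂(K)`: `SL₂(K)` is generated by its elementary unipotents — Mathlib's
  `Matrix.SL2.transvection_induction` — on which `ρ` is `exp(c e)`, `exp(c f)`, and `Φ` intertwines `f = ᶜΛ` with `f'`
  (`map_dual_of_semiconj`) hence the finite exponential series termwise), `LinearEquiv`-form **`conj_sl2Rep_eq`** (`Φ ρ_M(γ) Φ⁻¹ = ρ_N(γ)`).
* §2 TENSOR PRODUCTS = Künneth (André §1.3, Looijenga–Lunts (1.1)), at GROUP level: `IsZGrading.torus_tensor` (`tʰ_{M⊗N} = tʰ ⊗ tʰ'`,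
  `t ≠ 0`), **`HasLefschetzProperty.sl2Rep_tensor`** (`ρ_{M ⊗ N}(γ) = ρ_M(γ) ⊗ ρ_N(γ)` for the Lefschetz module
  `(M ⊗ N, h ⊗ 1 + 1 ⊗ h', e ⊗ 1 + 1 ⊗ e')`, whose partner is `f ⊗ 1 + 1 ⊗ f'` (`dual_tensor`): on unipotents
  `exp(c(a ⊗ 1 + 1 ⊗ a')) = exp(c a) ⊗ exp(c a')`, `exp_rTensor_add_lTensor`), `sl2Rep_tensor_tmul`.
* §3 DIRECT SUMS (Looijenga–Lunts (1.1)): **`sl2Rep_prodMap`** (`ρ_{M ⊕ N}(γ) = ρ_M(γ) ⊕ ρ_N(γ)`, by transport along the two projections),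
  `sl2Rep_prodMap_apply`.
* §4 INVARIANT FORMS (Looijenga–Lunts (1.3), integrated): `isAdjointPair_pow`, **`isAdjointPair_exp`** (if `(a, b)` is an adjoint pair for
  `φ` — `φ(a x, y) = φ(x, b y)` — and `a`, `b` are nilpotent then `(exp a, exp b)` is an adjoint pair), **`isAdjointPair_sl2Rep_inv`**,
  **`sl2Rep_isOrthogonal`** (`h`, `e` `φ`-skew ⇒ `f` is `φ`-skew (A1-96 `isSkewAdjoint_dual'`) ⇒ every `ρ(γ)` is a `φ`-ISOMETRY,
  Mathlib's `LinearMap.IsOrthogonal`: "`𝔤(𝔞, M) ⊂ aut(M, φ)`" exponentiated on the generating unipotents); and the POINCARÉ-type variant of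
  André §1.1 (`h` skew, `e` SELF-adjoint, then `ᶜΛ` is self-adjoint, g30-#3 `isSelfAdjoint_dual`): **`isAdjointPair_sl2Rep_of_coe_eq`**
  (`φ(ρ(a b ; c d) x, y) = φ(x, ρ(d b ; c a) y)` — the adjoint of `ρ(γ)` is `ρ` of the image of `γ` under the anti-automorphism of `SL₂`
  fixing both unipotent subgroups pointwise), `isSelfAdjoint_sl2Rep_of_coe_eq_weyl` (`w = ρ(0 −1 ; 1 0)` is self-adjoint).

## SCOPE (not formalised here)

Transport along a `K`-linear map into a Lefschetz module over a field EXTENSION `K'` (the setting of `LefschetzModuleTransport.lean`;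
it would require `SL₂(K) → SL₂(K')` on the group side) — only `K' = K` is treated.  The Clebsch–Gordan decomposition of `M ⊗ N`.

## References

* [Beauville2010SL2] A. Beauville, *The action of SL₂ on abelian varieties*, J. Ramanujan Math. Soc. 25 (2010) 253–263, arXiv:0805.1541, §3.
* [Andre1996Motifs] Y. André, *Pour une théorie inconditionnelle des motifs*, Publ. Math. IHÉS 83 (1996) 5–49, §1.1–§1.3 (pp. 10–13).
* [LooijengaLunts1997] E. Looijenga, V. A. Lunts, *A Lie algebra attached to a projective variety*, Invent. Math. 129 (1997) 361–412,
  §1 (1.1), (1.3) (pp. 4–5).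
-/

noncomputable section

namespace Literature.Algebra.Lie

open Module Function Set
open scoped Nat MatrixGroups TensorProduct
open HasLefschetzProperty (primitiveSpace mem_primitiveSpace_iff)

variable {K : Type*} [Field K] [CharZero K] {M : Type*} [AddCommGroup M] [Module K M] {h e : Module.End K M}

/-! ### §0 Preliminaries: the finite exponential with coefficients in `K`; `Φ exp(a) = exp(a') Φ` -/

/-- `exp a = Σ_{i<n} aⁱ/i!` with coefficients in `K`, for `aⁿ = 0`. [folklore] -/
private theorem exp_eq_sum_range' {V : Type*} [AddCommGroup V] [Module K V] {a : Module.End K V} {n : ℕ} (ha : a ^ n = 0) :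
    letI := Algebra.compHom (Module.End K V) (algebraMap ℚ K)
    IsNilpotent.exp a = ∑ i ∈ Finset.range n, ((i ! : ℕ) : K)⁻¹ • a ^ i := by
  letI := Algebra.compHom (Module.End K V) (algebraMap ℚ K)
  rw [IsNilpotent.exp_eq_sum ha]
  refine Finset.sum_congr rfl fun i _ ↦ ?_
  rw [Algebra.compHom_smul_def, map_inv₀, map_natCast]

section Transport

variable {M' : Type*} [AddCommGroup M'] [Module K M'] {h' e' : Module.End K M'} {Φ : M →ₗ[K] M'}

/-- **`Φ exp(a) = exp(a') Φ`** when `Φ a = a' Φ` (`a`, `a'` nilpotent): termwise in the finite exponential series, `Φ aⁱ = a'ⁱ Φ`.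
[folklore] -/
private theorem map_exp_apply_of_semiconj {a : Module.End K M} {a' : Module.End K M'} (ha : IsNilpotent a) (ha' : IsNilpotent a')
    (hΦ : ∀ x, Φ (a x) = a' (Φ x)) (x : M) :
    letI := Algebra.compHom (Module.End K M) (algebraMap ℚ K)
    letI := Algebra.compHom (Module.End K M') (algebraMap ℚ K)
    Φ (IsNilpotent.exp a x) = IsNilpotent.exp a' (Φ x) := by
  letI := Algebra.compHom (Module.End K M) (algebraMap ℚ K)
  letI := Algebra.compHom (Module.End K M') (algebraMap ℚ K)
  obtain ⟨n₁, hn₁⟩ := ha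
  obtain ⟨n₂, hn₂⟩ := ha'
  rw [exp_eq_sum_range' (pow_eq_zero_of_le (le_max_left n₁ n₂) hn₁), exp_eq_sum_range' (pow_eq_zero_of_le (le_max_right n₁ n₂) hn₂),
    LinearMap.sum_apply, LinearMap.sum_apply, map_sum]
  refine Finset.sum_congr rfl fun i _ ↦ ?_
  rw [LinearMap.smul_apply, LinearMap.smul_apply, map_smul, apply_pow_of_semiconj hΦ]

/-! ### §1 Transport along an intertwining map: `Φ tʰ = tʰ' Φ`, `Φ ρ(γ) = ρ'(γ) Φ` -/

/-- **`Φ tʰ = tʰ' Φ`** when `Φ h = h' Φ` (`Φ M_m ⊆ M'_m` and `tʰ = t^m` on both). [cite: Andre1996Motifs, §1.2 (p. 11, h = Σ (d−j) πʲ and its compatibilities)]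
[cite: Beauville2010SL2, §3 Theorem (proof, τ(t))] -/
theorem IsZGrading.map_torus_of_semiconj (hgr : IsZGrading h) (hgr' : IsZGrading h') (hh : ∀ x, Φ (h x) = h' (Φ x)) (t : K) (x : M) :
    Φ (hgr.torus t x) = hgr'.torus t (Φ x) := by
  suffices hΦ : Φ ∘ₗ hgr.torus t = hgr'.torus t ∘ₗ Φ from LinearMap.congr_fun hΦ x
  refine hgr.linearMap_ext fun m x hx ↦ ?_
  rw [LinearMap.comp_apply, LinearMap.comp_apply, hgr.torus_apply_of_mem t hx, map_smul,
    hgr'.torus_apply_of_mem t (apply_mem_degreeSpace_of_semiconj hh hx)]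

namespace HasLefschetzProperty

variable [FiniteDimensional K M] [FiniteDimensional K M']

/-- **TRANSPORT: `Φ ρ_M(γ) = ρ_{M'}(γ) Φ` for every `γ ∈ SL₂(K)`**, for a linear `Φ` with `Φ h = h' Φ`, `Φ e = e' Φ` — on the generating
unipotents `ρ(1 c ; 0 1) = exp(c e)`, `ρ(1 0 ; c 1) = exp(c f)` and `Φ f = f' Φ` (`map_dual_of_semiconj`, the uniqueness of the partner).
In particular `ρ` is compatible with isomorphisms of Lefschetz modules, with restriction to Lefschetz submodules and with the
projections of a direct sum. [cite: Andre1996Motifs, §1.2 (p. 11, "compatibles … aux isomorphismes") and §1.3 (p. 12)]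
[cite: LooijengaLunts1997, §1 (1.1) p. 4 (uniqueness of f)] [cite: Beauville2010SL2, §3 Theorem ("(unique) morphism")] -/
theorem map_sl2Rep_of_semiconj (L : HasLefschetzProperty h e) (hgr : IsZGrading h) (L' : HasLefschetzProperty h' e')
    (hgr' : IsZGrading h') (hh : ∀ x, Φ (h x) = h' (Φ x)) (he : ∀ x, Φ (e x) = e' (Φ x)) (γ : SL(2, K)) (x : M) :
    Φ (L.sl2Rep hgr γ x) = L'.sl2Rep hgr' γ (Φ x) := by
  letI := Algebra.compHom (Module.End K M) (algebraMap ℚ K)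
  letI := Algebra.compHom (Module.End K M') (algebraMap ℚ K)
  revert x
  refine Matrix.SL2.transvection_induction (fun γ ↦ ∀ x, Φ (L.sl2Rep hgr γ x) = L'.sl2Rep hgr' γ (Φ x)) (fun i j hij c x ↦ ?_)
    (fun γ₁ γ₂ h₁ h₂ x ↦ by rw [map_mul, map_mul, Module.End.mul_apply, Module.End.mul_apply, h₁, h₂]) γ
  rw [L.sl2Rep_transvection hgr hij c, L'.sl2Rep_transvection hgr' hij c]
  split_ifs
  · exact map_exp_apply_of_semiconj (L.isNilpotent_smul_e hgr c) (L'.isNilpotent_smul_e hgr' c)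
      (fun x ↦ by rw [LinearMap.smul_apply, LinearMap.smul_apply, map_smul, he]) x
  · exact map_exp_apply_of_semiconj (L.isNilpotent_smul_dual hgr c) (L'.isNilpotent_smul_dual hgr' c)
      (fun x ↦ by rw [LinearMap.smul_apply, LinearMap.smul_apply, map_smul, L.map_dual_of_semiconj hgr L' hgr' hh he]) x

/-- **`Φ ρ_M(γ) Φ⁻¹ = ρ_N(γ)`** for an isomorphism `Φ` of Lefschetz modules. [cite: Andre1996Motifs, §1.2 (p. 11) and §1.3 (p. 12)]
[cite: LooijengaLunts1997, §1 (1.1) p. 4] -/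
theorem conj_sl2Rep_eq (L : HasLefschetzProperty h e) (hgr : IsZGrading h) (L' : HasLefschetzProperty h' e') (hgr' : IsZGrading h')
    (Φ : M ≃ₗ[K] M') (hh : ∀ x, Φ (h x) = h' (Φ x)) (he : ∀ x, Φ (e x) = e' (Φ x)) (γ : SL(2, K)) :
    Φ.conj (L.sl2Rep hgr γ) = L'.sl2Rep hgr' γ := by
  ext y
  have h1 := L.map_sl2Rep_of_semiconj hgr L' hgr' (Φ := Φ.toLinearMap) hh he γ (Φ.symm y)
  rw [LinearEquiv.coe_coe, LinearEquiv.apply_symm_apply] at h1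
  rw [LinearEquiv.conj_apply_apply, h1]

end HasLefschetzProperty

end Transport

/-! ### §2 Tensor products (Künneth): `tʰ_{M⊗N} = tʰ ⊗ tʰ'`, `ρ_{M⊗N}(γ) = ρ_M(γ) ⊗ ρ_N(γ)` -/

section Tensor

variable {N : Type*} [AddCommGroup N] [Module K N] {h' e' : Module.End K N}

/-- **`tʰ_{M ⊗ N} = tʰ_M ⊗ tʰ_N`** for `t ≠ 0` (`M_i ⊗ N_j ⊆ (M ⊗ N)_{i+j}` and `t^{i+j} = tⁱ tʲ`). [cite: LooijengaLunts1997, §1 (1.1) p. 4 (tensor products of graded modules)]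
[cite: Beauville2010SL2, §3 Theorem (proof, τ(t))] -/
theorem IsZGrading.torus_tensor (hgr : IsZGrading h) (hgr' : IsZGrading h') {t : K} (ht : t ≠ 0) :
    (isZGrading_rTensor_add_lTensor hgr hgr').torus t = TensorProduct.map (hgr.torus t) (hgr'.torus t) := by
  refine TensorProduct.ext' fun x y ↦ ?_
  rw [TensorProduct.map_tmul]
  have hx : x ∈ ⨆ k : ℤ, degreeSpace h k := by rw [hgr]; exact Submodule.mem_top
  have hy : y ∈ ⨆ k : ℤ, degreeSpace h' k := by rw [hgr']; exact Submodule.mem_top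
  refine Submodule.iSup_induction _
    (motive := fun x ↦ (isZGrading_rTensor_add_lTensor hgr hgr').torus t (x ⊗ₜ[K] y) = hgr.torus t x ⊗ₜ[K] hgr'.torus t y) hx
    (fun i x hx ↦ ?_) (by rw [TensorProduct.zero_tmul, map_zero, map_zero, TensorProduct.zero_tmul])
    (fun x x' hx hx' ↦ by rw [TensorProduct.add_tmul, map_add, hx, hx', map_add, TensorProduct.add_tmul])
  refine Submodule.iSup_induction _
    (motive := fun y ↦ (isZGrading_rTensor_add_lTensor hgr hgr').torus t (x ⊗ₜ[K] y) = hgr.torus t x ⊗ₜ[K] hgr'.torus t y) hy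
    (fun j y hy ↦ ?_) (by rw [TensorProduct.tmul_zero, map_zero, map_zero, TensorProduct.tmul_zero])
    (fun y y' hy hy' ↦ by rw [TensorProduct.tmul_add, map_add, hy, hy', map_add, TensorProduct.tmul_add])
  rw [(isZGrading_rTensor_add_lTensor hgr hgr').torus_apply_of_mem t (tmul_mem_degreeSpace hx hy), hgr.torus_apply_of_mem t hx,
    hgr'.torus_apply_of_mem t hy, zpow_add₀ ht, mul_smul, ← TensorProduct.tmul_smul, TensorProduct.smul_tmul']

/-- `tʰ_{M ⊗ N}(x ⊗ y) = tʰ x ⊗ tʰ' y` (`t ≠ 0`). [cite: LooijengaLunts1997, §1 (1.1) p. 4] -/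
theorem IsZGrading.torus_tensor_tmul (hgr : IsZGrading h) (hgr' : IsZGrading h') {t : K} (ht : t ≠ 0) (x : M) (y : N) :
    (isZGrading_rTensor_add_lTensor hgr hgr').torus t (x ⊗ₜ[K] y) = hgr.torus t x ⊗ₜ[K] hgr'.torus t y := by
  rw [hgr.torus_tensor hgr' ht, TensorProduct.map_tmul]

namespace HasLefschetzProperty

variable [FiniteDimensional K M] [FiniteDimensional K N]

/-- **KÜNNETH AT GROUP LEVEL: `ρ_{M ⊗ N}(γ) = ρ_M(γ) ⊗ ρ_N(γ)`** for the Lefschetz module `(M ⊗ N, h ⊗ 1 + 1 ⊗ h', e ⊗ 1 + 1 ⊗ e')`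
(`H = h ⊗ 1 + 1 ⊗ h' ≠ 0`, which makes `f ⊗ 1 + 1 ⊗ f'` THE partner, `dual_tensor`): "l'isomorphisme de Künneth devient un isomorphisme
de `𝔰𝔩₂`-modules" — hence of `SL₂(K)`-modules: on the generating unipotents `exp(c(e ⊗ 1 + 1 ⊗ e')) = exp(c e) ⊗ exp(c e')`
(`exp_rTensor_add_lTensor`), likewise for `f`. [cite: Andre1996Motifs, §1.3 (p. 12; p. 13 "interprétation en termes de l'élément (0 1 ; −1 0) de SL₂")]
[cite: LooijengaLunts1997, §1 (1.1) p. 4 ("closed under … tensor products")] -/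
theorem sl2Rep_tensor (L : HasLefschetzProperty h e) (hgr : IsZGrading h) (L' : HasLefschetzProperty h' e') (hgr' : IsZGrading h')
    (h0 : h.rTensor N + h'.lTensor M ≠ 0) (γ : SL(2, K)) :
    (L.tensor hgr L' hgr').sl2Rep (isZGrading_rTensor_add_lTensor hgr hgr') γ =
      TensorProduct.map (L.sl2Rep hgr γ) (L'.sl2Rep hgr' γ) := by
  letI := Algebra.compHom (Module.End K M) (algebraMap ℚ K)
  letI := Algebra.compHom (Module.End K N) (algebraMap ℚ K)
  letI := Algebra.compHom (Module.End K (M ⊗[K] N)) (algebraMap ℚ K)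
  refine Matrix.SL2.transvection_induction
    (fun γ ↦ (L.tensor hgr L' hgr').sl2Rep (isZGrading_rTensor_add_lTensor hgr hgr') γ =
      TensorProduct.map (L.sl2Rep hgr γ) (L'.sl2Rep hgr' γ)) (fun i j hij c ↦ ?_)
    (fun γ₁ γ₂ h₁ h₂ ↦ by rw [map_mul, map_mul, map_mul, h₁, h₂, TensorProduct.map_mul]) γ
  rw [(L.tensor hgr L' hgr').sl2Rep_transvection _ hij c, L.sl2Rep_transvection hgr hij c, L'.sl2Rep_transvection hgr' hij c]
  split_ifs
  · rw [smul_add, ← LinearMap.rTensor_smul, ← LinearMap.lTensor_smul,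
      exp_rTensor_add_lTensor (L.isNilpotent_smul_e hgr c) (L'.isNilpotent_smul_e hgr' c)]
  · rw [L.dual_tensor hgr L' hgr' h0, smul_add, ← LinearMap.rTensor_smul, ← LinearMap.lTensor_smul,
      exp_rTensor_add_lTensor (L.isNilpotent_smul_dual hgr c) (L'.isNilpotent_smul_dual hgr' c)]

/-- `ρ_{M ⊗ N}(γ)(x ⊗ y) = ρ_M(γ) x ⊗ ρ_N(γ) y`. [cite: Andre1996Motifs, §1.3 (pp. 12–13)] -/
theorem sl2Rep_tensor_tmul (L : HasLefschetzProperty h e) (hgr : IsZGrading h) (L' : HasLefschetzProperty h' e')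
    (hgr' : IsZGrading h') (h0 : h.rTensor N + h'.lTensor M ≠ 0) (γ : SL(2, K)) (x : M) (y : N) :
    (L.tensor hgr L' hgr').sl2Rep (isZGrading_rTensor_add_lTensor hgr hgr') γ (x ⊗ₜ[K] y) =
      L.sl2Rep hgr γ x ⊗ₜ[K] L'.sl2Rep hgr' γ y := by
  rw [L.sl2Rep_tensor hgr L' hgr' h0, TensorProduct.map_tmul]

/-! ### §3 Direct sums: `ρ_{M ⊕ N}(γ) = ρ_M(γ) ⊕ ρ_N(γ)` -/

/-- `ρ_{M ⊕ N}(γ)(x, y) = (ρ_M(γ) x, ρ_N(γ) y)` (transport along the two projections, which intertwine `h ⊕ h'`, `e ⊕ e'` with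
`h`, `e` and `h'`, `e'`). [cite: LooijengaLunts1997, §1 (1.1) p. 4 ("closed under direct sums", "e_{(a',a'')}(m', m'') = (e_{a'} m', e_{a''} m'')")] -/
theorem sl2Rep_prodMap_apply (L : HasLefschetzProperty h e) (hgr : IsZGrading h) (L' : HasLefschetzProperty h' e')
    (hgr' : IsZGrading h') (γ : SL(2, K)) (z : M × N) :
    (L.prodMap hgr L' hgr').sl2Rep (isZGrading_prodMap hgr hgr') γ z = (L.sl2Rep hgr γ z.1, L'.sl2Rep hgr' γ z.2) :=
  Prod.ext
    ((L.prodMap hgr L' hgr').map_sl2Rep_of_semiconj (isZGrading_prodMap hgr hgr') L hgr (Φ := LinearMap.fst K M N)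
      (fun _ ↦ rfl) (fun _ ↦ rfl) γ z)
    ((L.prodMap hgr L' hgr').map_sl2Rep_of_semiconj (isZGrading_prodMap hgr hgr') L' hgr' (Φ := LinearMap.snd K M N)
      (fun _ ↦ rfl) (fun _ ↦ rfl) γ z)

/-- **`ρ_{M ⊕ N}(γ) = ρ_M(γ) ⊕ ρ_N(γ)`.** [cite: LooijengaLunts1997, §1 (1.1) p. 4] -/
theorem sl2Rep_prodMap (L : HasLefschetzProperty h e) (hgr : IsZGrading h) (L' : HasLefschetzProperty h' e')
    (hgr' : IsZGrading h') (γ : SL(2, K)) :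
    (L.prodMap hgr L' hgr').sl2Rep (isZGrading_prodMap hgr hgr') γ = (L.sl2Rep hgr γ).prodMap (L'.sl2Rep hgr' γ) :=
  LinearMap.ext fun z ↦ by rw [sl2Rep_prodMap_apply, LinearMap.prodMap_apply]

end HasLefschetzProperty

end Tensor

/-! ### §4 Invariant bilinear forms: `ρ(γ)` is an isometry of every form for which `h`, `e` are skew; the Poincaré-type variant -/

section InvariantForm

open LinearMap (BilinForm)

variable {B : BilinForm K M}

omit [CharZero K] in
/-- Powers of an adjoint pair form an adjoint pair: `φ(aⁱ x, y) = φ(x, bⁱ y)`. [cite: LooijengaLunts1997, §1 (1.3) p. 5] -/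
theorem isAdjointPair_pow {a b : Module.End K M} (hab : LinearMap.IsAdjointPair B B a b) (i : ℕ) :
    LinearMap.IsAdjointPair B B (⇑(a ^ i)) (⇑(b ^ i)) := by
  induction i with
  | zero => rw [pow_zero, pow_zero]; exact LinearMap.isAdjointPair_one
  | succ i ih =>
    have h1 : LinearMap.IsAdjointPair B B (⇑(a * a ^ i)) (⇑(b ^ i * b)) := LinearMap.IsAdjointPair.mul hab ih
    rwa [← pow_succ', ← pow_succ] at h1

/-- **The exponentials of a nilpotent adjoint pair form an adjoint pair: `φ(exp(a) x, y) = φ(x, exp(b) y)`** (termwise in the finite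
exponential series). With `b = −a`: the exponential of an infinitesimal isometry is an isometry. [cite: LooijengaLunts1997, §1 (1.3) p. 5 ("𝔤(𝔞, M) is then a subalgebra of aut(M, φ)")] -/
theorem isAdjointPair_exp {a b : Module.End K M} (ha : IsNilpotent a) (hb : IsNilpotent b) (hab : LinearMap.IsAdjointPair B B a b) :
    letI := Algebra.compHom (Module.End K M) (algebraMap ℚ K)
    LinearMap.IsAdjointPair B B (⇑(IsNilpotent.exp a)) (⇑(IsNilpotent.exp b)) := by
  letI := Algebra.compHom (Module.End K M) (algebraMap ℚ K)
  obtain ⟨n₁, hn₁⟩ := ha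
  obtain ⟨n₂, hn₂⟩ := hb
  rw [exp_eq_sum_range' (pow_eq_zero_of_le (le_max_left n₁ n₂) hn₁), exp_eq_sum_range' (pow_eq_zero_of_le (le_max_right n₁ n₂) hn₂)]
  suffices hn : ∀ n : ℕ, LinearMap.IsAdjointPair B B (⇑(∑ i ∈ Finset.range n, ((i ! : ℕ) : K)⁻¹ • a ^ i))
      (⇑(∑ i ∈ Finset.range n, ((i ! : ℕ) : K)⁻¹ • b ^ i)) from hn _
  intro n
  induction n with
  | zero => rw [Finset.sum_range_zero, Finset.sum_range_zero]; exact LinearMap.isAdjointPair_zero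
  | succ n ih =>
    rw [Finset.sum_range_succ, Finset.sum_range_succ]
    exact ih.add ((isAdjointPair_pow hab n).smul _)

omit [CharZero K] in
/-- `φ((c a) x, y) = φ(x, (−(c a)) y)` for a `φ`-skew `a`. [cite: LooijengaLunts1997, §1 (1.3) p. 5] -/
private theorem isAdjointPair_smul_neg_smul {a : Module.End K M} (ha : B.IsSkewAdjoint a) (c : K) :
    LinearMap.IsAdjointPair B B (⇑(c • a)) (⇑(-(c • a))) := fun x y ↦ by
  have h1 := ha x y
  simp only [Pi.neg_apply, map_neg] at h1
  simp only [LinearMap.smul_apply, LinearMap.neg_apply, map_smul, map_neg, smul_eq_mul, h1, mul_neg]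

omit [CharZero K] in
/-- `φ((c a) x, y) = φ(x, (c a) y)` for a `φ`-self-adjoint `a`. [cite: Andre1996Motifs, §1.1 (p. 11)] -/
private theorem isAdjointPair_smul_smul {a : Module.End K M} (ha : B.IsSelfAdjoint a) (c : K) :
    LinearMap.IsAdjointPair B B (⇑(c • a)) (⇑(c • a)) := fun x y ↦ by
  have h1 := ha x y
  simp only [LinearMap.smul_apply, map_smul, smul_eq_mul, h1]

omit [CharZero K] in
/-- `det (d b ; c a) = 1` for `(a b ; c d) ∈ SL₂`. [folklore] -/
private theorem det_swap_eq_one (γ : SL(2, K)) :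
    Matrix.det !![(γ : Matrix (Fin 2) (Fin 2) K) 1 1, (γ : Matrix (Fin 2) (Fin 2) K) 0 1;
      (γ : Matrix (Fin 2) (Fin 2) K) 1 0, (γ : Matrix (Fin 2) (Fin 2) K) 0 0] = 1 := by
  have h1 := γ.prop
  rw [Matrix.det_fin_two] at h1
  rw [Matrix.det_fin_two_of]
  linear_combination h1

namespace HasLefschetzProperty

variable [FiniteDimensional K M]

/-- **`(ρ(γ), ρ(γ⁻¹))` is an adjoint pair for every bilinear form `φ` for which `h` and `e` are skew** (`φ(h x, y) + φ(x, h y) = 0`,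
`φ(e x, y) + φ(x, e y) = 0`): then the partner `f` is `φ`-skew too (Looijenga–Lunts (1.3), `isSkewAdjoint_dual'`; `f = 0` if `h = 0`),
`ρ` of a generating unipotent is `exp(c e)` or `exp(c f)` with inverse `exp(−c e)`, `exp(−c f)`, and `(exp(u), exp(−u))` is an
adjoint pair for `φ`-skew nilpotent `u`. [cite: LooijengaLunts1997, §1 (1.3) p. 5 ("So 𝔤(𝔞, M) is then a subalgebra of aut(M, φ)")] -/
theorem isAdjointPair_sl2Rep_inv (L : HasLefschetzProperty h e) (hgr : IsZGrading h) (hh : B.IsSkewAdjoint h)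
    (he : B.IsSkewAdjoint e) (γ : SL(2, K)) : LinearMap.IsAdjointPair B B (L.sl2Rep hgr γ) (L.sl2Rep hgr γ⁻¹) := by
  letI := Algebra.compHom (Module.End K M) (algebraMap ℚ K)
  have hf : B.IsSkewAdjoint (L.dual hgr) := by
    by_cases h0 : h = 0
    · intro x y
      simp only [L.dual_eq_zero_of_eq_zero hgr h0, Pi.neg_apply, LinearMap.zero_apply, map_zero, LinearMap.zero_apply, neg_zero]
    · exact L.isSkewAdjoint_dual' hgr h0 hh he
  refine Matrix.SL2.transvection_induction (fun γ ↦ LinearMap.IsAdjointPair B B (L.sl2Rep hgr γ) (L.sl2Rep hgr γ⁻¹))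
    (fun i j hij c ↦ ?_) (fun γ₁ γ₂ h₁ h₂ ↦ by rw [mul_inv_rev, map_mul, map_mul]; exact h₁.mul h₂) γ
  rw [Matrix.SpecialLinearGroup.transvection_inv, L.sl2Rep_transvection hgr hij c, L.sl2Rep_transvection hgr hij (-c)]
  split_ifs
  · rw [neg_smul]
    exact isAdjointPair_exp (L.isNilpotent_smul_e hgr c) (L.isNilpotent_smul_e hgr c).neg (isAdjointPair_smul_neg_smul he c)
  · rw [neg_smul]
    exact isAdjointPair_exp (L.isNilpotent_smul_dual hgr c) (L.isNilpotent_smul_dual hgr c).neg (isAdjointPair_smul_neg_smul hf c)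

/-- **`SL₂(K)` ACTS BY `φ`-ISOMETRIES: `φ(ρ(γ) x, ρ(γ) y) = φ(x, y)`** for every bilinear form `φ` for which `h` and `e` are skew
(Mathlib's `LinearMap.IsOrthogonal`) — the integrated form of "`𝔤(𝔞, M)` is then a subalgebra of `aut(M, φ)`" for the Lefschetz
`𝔰𝔩₂`. [cite: LooijengaLunts1997, §1 (1.3) p. 5] -/
theorem sl2Rep_isOrthogonal (L : HasLefschetzProperty h e) (hgr : IsZGrading h) (hh : B.IsSkewAdjoint h) (he : B.IsSkewAdjoint e)
    (γ : SL(2, K)) : B.IsOrthogonal (L.sl2Rep hgr γ) := fun x y ↦ by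
  rw [L.isAdjointPair_sl2Rep_inv hgr hh he γ x (L.sl2Rep hgr γ y), ← Module.End.mul_apply, ← map_mul, inv_mul_cancel, map_one,
    Module.End.one_apply]

/-- **POINCARÉ-TYPE PAIRINGS (`h` skew, `e` SELF-adjoint: "`L` […] auto-adjoint", then "`ᶜΛ` […] auto-adjoint"): the adjoint of
`ρ(a b ; c d)` is `ρ(d b ; c a)`** — `φ(ρ(γ) x, y) = φ(x, ρ(γ') y)` for `γ' =` the image of `γ` under the anti-automorphism
`(a b ; c d) ↦ (d b ; c a)` of `SL₂` (the one fixing both unipotent subgroups pointwise: `exp(c e)`, `exp(c ᶜΛ)` are self-adjoint).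
[cite: Andre1996Motifs, §1.1 (p. 11, "L […] auto-adjoint", "ᶜΛ […] auto-adjoint") and Prop. 1.2 (p. 11)] -/
theorem isAdjointPair_sl2Rep_of_coe_eq (L : HasLefschetzProperty h e) (hgr : IsZGrading h) (hh : B.IsSkewAdjoint h)
    (he : B.IsSelfAdjoint e) (γ γ' : SL(2, K))
    (hγ' : (γ' : Matrix (Fin 2) (Fin 2) K) = !![(γ : Matrix (Fin 2) (Fin 2) K) 1 1, (γ : Matrix (Fin 2) (Fin 2) K) 0 1;
      (γ : Matrix (Fin 2) (Fin 2) K) 1 0, (γ : Matrix (Fin 2) (Fin 2) K) 0 0]) :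
    LinearMap.IsAdjointPair B B (L.sl2Rep hgr γ) (L.sl2Rep hgr γ') := by
  letI := Algebra.compHom (Module.End K M) (algebraMap ℚ K)
  have hf : B.IsSelfAdjoint (L.dual hgr) := L.isSelfAdjoint_dual hgr hh he
  revert γ' hγ'
  refine Matrix.SL2.transvection_induction
    (fun γ ↦ ∀ γ' : SL(2, K), (γ' : Matrix (Fin 2) (Fin 2) K) = !![(γ : Matrix (Fin 2) (Fin 2) K) 1 1, (γ : Matrix (Fin 2) (Fin 2) K) 0 1;
      (γ : Matrix (Fin 2) (Fin 2) K) 1 0, (γ : Matrix (Fin 2) (Fin 2) K) 0 0] →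
      LinearMap.IsAdjointPair B B (L.sl2Rep hgr γ) (L.sl2Rep hgr γ'))
    (fun i j hij c γ' hγ' ↦ ?_) (fun γ₁ γ₂ h₁ h₂ γ' hγ' ↦ ?_) γ
  · have hγ'' : γ' = Matrix.SpecialLinearGroup.transvection hij c := by
      refine Subtype.ext ?_
      rw [hγ']
      fin_cases i <;> fin_cases j
      · exact absurd rfl hij
      · ext a b; fin_cases a <;> fin_cases b <;>
          simp [Matrix.SpecialLinearGroup.transvection, Matrix.transvection, Matrix.single]
      · ext a b; fin_cases a <;> fin_cases b <;>
          simp [Matrix.SpecialLinearGroup.transvection, Matrix.transvection, Matrix.single]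
      · exact absurd rfl hij
    rw [hγ'', L.sl2Rep_transvection hgr hij c]
    split_ifs
    · exact isAdjointPair_exp (L.isNilpotent_smul_e hgr c) (L.isNilpotent_smul_e hgr c) (isAdjointPair_smul_smul he c)
    · exact isAdjointPair_exp (L.isNilpotent_smul_dual hgr c) (L.isNilpotent_smul_dual hgr c) (isAdjointPair_smul_smul hf c)
  · have e₁ := h₁ (show SL(2, K) from ⟨_, det_swap_eq_one γ₁⟩) rfl
    have e₂ := h₂ (show SL(2, K) from ⟨_, det_swap_eq_one γ₂⟩) rfl
    have h3 : γ' = (show SL(2, K) from ⟨_, det_swap_eq_one γ₂⟩) * (show SL(2, K) from ⟨_, det_swap_eq_one γ₁⟩) := by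
      refine Subtype.ext ?_
      rw [hγ', Matrix.SpecialLinearGroup.coe_mul, Matrix.SpecialLinearGroup.coe_mul]
      ext a b; fin_cases a <;> fin_cases b <;> simp [Matrix.mul_apply, Fin.sum_univ_two] <;> ring
    rw [h3, map_mul, map_mul]
    exact e₁.mul e₂

/-- In particular **`w = ρ(0 −1 ; 1 0)` and `w² = ρ(−1)` are `φ`-self-adjoint and `φ(tʰ x, y) = φ(x, (t⁻¹)ʰ y)`** for a Poincaré-type
pairing (`(0 −1 ; 1 0)` and `−1` are fixed by `(a b ; c d) ↦ (d b ; c a)`). [cite: Andre1996Motifs, §1.1 (p. 11) and §1.3 (p. 13, "(0 1 ; −1 0)")] -/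
theorem isSelfAdjoint_sl2Rep_of_coe_eq_weyl (L : HasLefschetzProperty h e) (hgr : IsZGrading h) (hh : B.IsSkewAdjoint h)
    (he : B.IsSelfAdjoint e) (γ : SL(2, K)) (hγ : (γ : Matrix (Fin 2) (Fin 2) K) = !![0, -1; 1, 0]) :
    B.IsSelfAdjoint (L.sl2Rep hgr γ) :=
  L.isAdjointPair_sl2Rep_of_coe_eq hgr hh he γ γ (by rw [hγ]; ext a b; fin_cases a <;> fin_cases b <;> simp)

end HasLefschetzProperty

end InvariantForm

end Literature.Algebra.Lie
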